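import Mathlib.Probability.Moments.Variance
import Mathlib.Probability.Moments.Covariance
import Mathlib.Algebra.Order.Chebyshev
import HarnessLib

/-!
# The importance-sampling effective sample size `ESS^ = (Σ w)²/Σ w² = 1/Σ w̄²`: the `L₂`-discrepancy
# form, `1 ≤ ESS^ ≤ N`, the coefficient-of-variation form, and the variance of a weighted combination
# of uncorrelated draws `σ²/ESS^` (Elvira–Martino–Robert 2022, eq. (21)–(27))

Topic `Probability/ImportanceSampling`; namespace `Literature.Probability.ImportanceSampling`. Finite
weight vectors `w : Fin N → ℝ`; everything is PROVED (algebra + one second-moment identity over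
Mathlib's `variance`/`covariance`); no named fact, no axiom, no law.

Source, VERBATIM [cite: ElviraMartinoRobert2022, §3–§4.1 eq. (21)–(27)] (V. Elvira, L. Martino,
C. P. Robert, *Rethinking the effective sample size*, Int. Stat. Rev. 90 (2022) 525–550,
arXiv:1809.04129; held text `galaxy-pdf-2201181207587689900`, chunks p0007–p0008, p0013–p0015): "the
rule of thumb … `ESS^ = N (1/N Σ_n w_n)² / (1/N Σ_n w_n²) = 1/Σ_{n=1}^N w̄_n²` (21) … where `w̄_n`
represent the normalized importance weights … 1. The approximation is bounded as `1 ≤ ESS^ ≤ N`. …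
4.1.1 … the Euclidean distance `L₂` between the uniform probability mass function … `w̄* = [1/N, …, 1/N]`,
and the pmf described by `w̄` …: `L₂ = ‖w̄ - w̄*‖₂ = √(Σ_n (w̄_n - 1/N)²)` … `= √((Σ_n w̄_n²) - 1/N)
= √(1/ESS^ - 1/N)` (22) … `ESS^ = 1/(L₂² + 1/N)` (23) … since `L₂ ≥ 0`, the maximum value … is
`ESS^ = N`, when `L₂ = 0` … the minimum … `ESS^ = 1`, when `w̄` is any permutation of the vector
`[1, 0, …, 0]`. … 4.1.2 ESS as loss of efficiency in a convex combination of independent r.v.'s … `N`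
i.i.d. r.v.'s `Z_n` … with variance `σ_Z²` … `C_w = Σ_n w_n Z_n / Σ_n w_n` (24) … The variance of `C_w`
can be readily computed as `σ²_{C_w} = Σ_n w_n² σ_Z² / (Σ_n w_n)² = σ_Z²/ESS^` (25), i.e., the variance
of the combination `C_w` is equivalent to the variance of the equal-weights combination of `ESS^`
samples. … 4.1.3 … `CV = √((1/N) Σ_n (N w̄_n - 1)²)` (26) … `ESS^ = N/(1 + CV²) = 1/Σ_n w̄_n²` (27)."

* `essHat w = (Σ w)²/Σ w²` — (21), unnormalised form; `normWeight w n = w n/Σ w`;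
  `sum_normWeight` (`= 1`), **`essHat_eq_inv_sum_normWeight_sq`** — (21) `ESS^ = 1/Σ w̄²`;
* **`sum_normWeight_sub_inv_sq`** — (22) `Σ (w̄_n - 1/N)² = Σ w̄_n² - 1/N`; **`essHat_eq_inv_l2`** —
  (23) `ESS^ = 1/(L₂² + 1/N)`;
* **`essHat_le_card`** (`ESS^ ≤ N`, Cauchy–Schwarz, any real weights), **`one_le_essHat`**
  (`1 ≤ ESS^`, nonnegative weights), `essHat_const` (`= N` for equal weights), `essHat_single`
  (`= 1` for a vertex `[c, 0, …, 0]`);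
* `cvSq`, **`essHat_eq_card_div_one_add_cvSq`** — (26)–(27) `ESS^ = N/(1 + CV²)`;
* **`variance_weightedComb`** — (25): for square-integrable, pairwise UNCORRELATED `Z_n` of common
  variance `σ²` (the printed "i.i.d." is more than is used) and deterministic weights,
  `Var[Σ w_n Z_n/Σ w_n] = σ² · Σ w_n²/(Σ w_n)² = σ²/ESS^`.

* APPENDED (lit g29) — the `L_∞` effective sample size and the ORDERING of four ESS functions,
  VERBATIM from [cite: MartinoElviraLouzada2017, §4 eq. (18)–(21), §5.3 eq. (36), §5.5] (L. Martino,
  V. Elvira, F. Louzada, *Effective sample size for importance sampling based on discrepancy measures*,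
  Signal Processing 131 (2017) 386–401, arXiv:1602.03572; held text `galaxy-pdf--3250044780020192420`,
  chunks p0007:L1–L22, p0010:L18–L25, p0015:L25–p0016:L3): "`V_N^{(0)}(w̄) = N - N_Z` (18) where `N_Z`
  is the number of zeros in `w̄` … (19) … `‖w̄‖_∞ = max[|w̄_1|, …, |w̄_N|] = 1/D_N(w̄)` (20), where
  `D_N^{(∞)}(w̄) = 1/max[w̄_1, …, w̄_N]` (21), is another valid ESS measure. We have also
  `1 ≤ D_N^{(∞)}(w̄) ≤ N` … `S_N^{(1/2)}(w̄) = (Σ_n √w̄_n)²` (36) … 5.5 Summary … The following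
  ordering inequalities `D_N^{(∞)}(w̄) ≤ P_N^{(2)}(w̄) ≤ S_N^{(1/2)}(w̄) ≤ V_N^{(0)}(w̄)`, `∀ w̄ ∈ S_N`,
  can be also easily proved." (`P_N^{(2)} = ESS^`, eq. (6)). Typed: `maxNormWeight` (`max w̄`),
  `essMax` (`D^{(∞)}`), `essSqrt` (`S^{(1/2)}`), `essSupport` (`V^{(0)}`); `inv_card_le_maxNormWeight`,
  `maxNormWeight_le_one`, **`one_le_essMax`**, **`essMax_le_card`**; the chain **`essMax_le_essHat`**
  (`Σ w̄² ≤ max w̄`), **`essHat_le_essSqrt`** (Cauchy–Schwarz twice on `s = √w̄`: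
  `(Σs²)³ ≤ (Σs)²(Σs⁴)`), **`essSqrt_le_essSupport`** (Cauchy–Schwarz on the support); and the immediate
  companion `essHat_le_inv_maxNormWeight_sq` (`ESS^ ≤ 1/(max w̄)²`, since `Σ w̄² ≥ (max w̄)²` — not in
  the printed chain; it is what a "largest share of `Σ w²`" cell reads: that share is `(max w̄)²·ESS^ ≤ 1`).

Not here: the exact `ESS = N·Var[Ī]/MSE[Ĩ]` of the paper's (5)/(8) and its delta-method link to `ESS^`
(approximations, §3), the rest of the Huggins–Roy / `P^{(r)}`, `D^{(r)}` families, random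
(self-normalised) weights.
-/

noncomputable section

open Finset MeasureTheory ProbabilityTheory

namespace Literature.Probability.ImportanceSampling

variable {N : ℕ}

/-! ### (21): the statistic and its normalised form -/

/-- `ESS^ = (Σ_n w_n)²/Σ_n w_n²` (`= N (w̄)²/(w²)‾`, eq. (21), unnormalised weights).
[cite: ElviraMartinoRobert2022, §3.1 eq. (21)] -/
def essHat (w : Fin N → ℝ) : ℝ := (∑ n, w n) ^ 2 / ∑ n, w n ^ 2

/-- The normalised weights `w̄_n = w_n/Σ_m w_m`. [cite: ElviraMartinoRobert2022, §1 eq. (1)] -/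
def normWeight (w : Fin N → ℝ) (n : Fin N) : ℝ := w n / ∑ m, w m

/-- `Σ_n w̄_n = 1` (`Σ w ≠ 0`). [cite: ElviraMartinoRobert2022, §1 eq. (1)] -/
theorem sum_normWeight (w : Fin N → ℝ) (hS : ∑ n, w n ≠ 0) : ∑ n, normWeight w n = 1 := by
  simp only [normWeight]
  rw [← Finset.sum_div, div_self hS]

/-- **(21)**: `ESS^ = 1/Σ_n w̄_n²` (`Σ w ≠ 0`). [cite: ElviraMartinoRobert2022, §3.1 eq. (21)] -/
theorem essHat_eq_inv_sum_normWeight_sq (w : Fin N → ℝ) (hS : ∑ n, w n ≠ 0) :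
    essHat w = 1 / ∑ n, normWeight w n ^ 2 := by
  simp only [essHat, normWeight, div_pow]
  rw [← Finset.sum_div]
  field_simp

/-! ### (22)–(23): the `L₂` discrepancy to the uniform weights -/

/-- **(22)**: `L₂² = Σ_n (w̄_n - 1/N)² = Σ_n w̄_n² - 1/N` (`Σ w ≠ 0`, `N ≠ 0`).
[cite: ElviraMartinoRobert2022, §4.1.1 eq. (22)] -/
theorem sum_normWeight_sub_inv_sq (w : Fin N → ℝ) (hS : ∑ n, w n ≠ 0) (hN : N ≠ 0) :
    ∑ n, (normWeight w n - 1 / N) ^ 2 = ∑ n, normWeight w n ^ 2 - 1 / N := by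
  have hN' : (N : ℝ) ≠ 0 := by exact_mod_cast hN
  have h1 := sum_normWeight w hS
  have : ∀ n, (normWeight w n - 1 / N) ^ 2 =
      normWeight w n ^ 2 - 2 / N * normWeight w n + 1 / (N : ℝ) ^ 2 := fun n ↦ by ring
  simp only [this, Finset.sum_add_distrib, Finset.sum_sub_distrib, ← Finset.mul_sum, h1,
    Finset.sum_const, Finset.card_univ, Fintype.card_fin, nsmul_eq_mul]
  field_simp
  ring

/-- **(23)**: `ESS^ = 1/(L₂² + 1/N)` (`Σ w ≠ 0`, `N ≠ 0`): the statistic is a decreasing function of the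
Euclidean distance of `w̄` to the uniform weights and of nothing else.
[cite: ElviraMartinoRobert2022, §4.1.1 eq. (23)] -/
theorem essHat_eq_inv_l2 (w : Fin N → ℝ) (hS : ∑ n, w n ≠ 0) (hN : N ≠ 0) :
    essHat w = 1 / (∑ n, (normWeight w n - 1 / N) ^ 2 + 1 / N) := by
  rw [sum_normWeight_sub_inv_sq w hS hN, sub_add_cancel, essHat_eq_inv_sum_normWeight_sq w hS]

/-- If the weights do not sum to zero, their squares do not either (plumbing). [folklore] -/
private theorem sum_sq_ne_zero (w : Fin N → ℝ) (hS : ∑ n, w n ≠ 0) : ∑ n, w n ^ 2 ≠ 0 := by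
  intro hQ
  have hz : ∀ n, w n = 0 := fun n ↦ by
    have := (Finset.sum_eq_zero_iff_of_nonneg fun m _ ↦ sq_nonneg (w m)).mp hQ n (mem_univ n)
    exact pow_eq_zero_iff (n := 2) (by norm_num) |>.mp this
  exact hS (Finset.sum_eq_zero fun n _ ↦ hz n)

/-! ### `1 ≤ ESS^ ≤ N` and the two extreme configurations -/

/-- **`ESS^ ≤ N`** for ANY real weights (Cauchy–Schwarz; `= 0 ≤ N` by convention if all weights
vanish). [cite: ElviraMartinoRobert2022, §3.3 item 1, §4.1.1] -/
theorem essHat_le_card (w : Fin N → ℝ) : essHat w ≤ N := by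
  unfold essHat
  rcases eq_or_ne (∑ n, w n ^ 2) 0 with hQ | hQ
  · rw [hQ, div_zero]; exact Nat.cast_nonneg N
  · have hQpos : 0 < ∑ n, w n ^ 2 :=
      lt_of_le_of_ne (Finset.sum_nonneg fun n _ ↦ sq_nonneg (w n)) (Ne.symm hQ)
    rw [div_le_iff₀ hQpos]
    have := sq_sum_le_card_mul_sum_sq (s := Finset.univ) (f := w)
    simpa only [Finset.card_univ, Fintype.card_fin] using this

/-- **`1 ≤ ESS^`** for NONNEGATIVE weights not all zero (`Σ_n w_n² ≤ (Σ_n w_n)²`).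
[cite: ElviraMartinoRobert2022, §3.3 item 1, §4.1.1] -/
theorem one_le_essHat (w : Fin N → ℝ) (hw : ∀ n, 0 ≤ w n) (hS : ∑ n, w n ≠ 0) : 1 ≤ essHat w := by
  unfold essHat
  have hSpos : 0 < ∑ n, w n := lt_of_le_of_ne (Finset.sum_nonneg fun n _ ↦ hw n) (Ne.symm hS)
  have hle : ∑ n, w n ^ 2 ≤ (∑ n, w n) ^ 2 :=
    Finset.sum_sq_le_sq_sum_of_nonneg fun n _ ↦ hw n
  have hQpos : 0 < ∑ n, w n ^ 2 :=
    lt_of_le_of_ne (Finset.sum_nonneg fun n _ ↦ sq_nonneg (w n)) (Ne.symm (sum_sq_ne_zero w hS))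
  rw [le_div_iff₀ hQpos, one_mul]
  exact hle

/-- Equal weights give the maximum, `ESS^ = N` (`c ≠ 0`, `N ≠ 0`).
[cite: ElviraMartinoRobert2022, §4.1.1] ("`ESS^ = N`, when `L₂ = 0`") -/
theorem essHat_const {c : ℝ} (hc : c ≠ 0) (hN : N ≠ 0) : essHat (fun _ : Fin N ↦ c) = N := by
  have hN' : (N : ℝ) ≠ 0 := by exact_mod_cast hN
  simp only [essHat, Finset.sum_const, Finset.card_univ, Fintype.card_fin, nsmul_eq_mul]
  field_simp

/-- A single nonzero weight gives the minimum, `ESS^ = 1`.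
[cite: ElviraMartinoRobert2022, §4.1.1] ("`ESS^ = 1`, when `w̄` is any permutation of `[1, 0, …, 0]`") -/
theorem essHat_single (i : Fin N) {c : ℝ} (hc : c ≠ 0) : essHat (Pi.single i c) = 1 := by
  simp only [essHat]
  rw [Finset.sum_eq_single i (fun n _ hn ↦ by simp [hn]) (fun h ↦ absurd (mem_univ i) h),
    Finset.sum_eq_single i (fun n _ hn ↦ by simp [hn]) (fun h ↦ absurd (mem_univ i) h)]
  simp only [Pi.single_eq_same]
  exact div_self (pow_ne_zero 2 hc)

/-! ### (26)–(27): the coefficient-of-variation form -/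

/-- `CV² = (1/N) Σ_n (N w̄_n - 1)²` (eq. (26), squared). [cite: ElviraMartinoRobert2022, §4.1.3 eq. (26)] -/
def cvSq (w : Fin N → ℝ) : ℝ := (∑ n, ((N : ℝ) * normWeight w n - 1) ^ 2) / N

/-- **(27)**: `ESS^ = N/(1 + CV²)` (`Σ w ≠ 0`, `N ≠ 0`). [cite: ElviraMartinoRobert2022, §4.1.3 eq. (27)] -/
theorem essHat_eq_card_div_one_add_cvSq (w : Fin N → ℝ) (hS : ∑ n, w n ≠ 0) (hN : N ≠ 0) :
    essHat w = N / (1 + cvSq w) := by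
  have hN' : (N : ℝ) ≠ 0 := by exact_mod_cast hN
  have h1 := sum_normWeight w hS
  have hcv : cvSq w = N * ∑ n, normWeight w n ^ 2 - 1 := by
    unfold cvSq
    have : ∀ n, ((N : ℝ) * normWeight w n - 1) ^ 2 =
        (N : ℝ) ^ 2 * normWeight w n ^ 2 - 2 * N * normWeight w n + 1 := fun n ↦ by ring
    simp only [this, Finset.sum_add_distrib, Finset.sum_sub_distrib, ← Finset.mul_sum, h1,
      Finset.sum_const, Finset.card_univ, Fintype.card_fin, nsmul_eq_mul]
    field_simp
    ring
  have hpos : ∑ n, normWeight w n ^ 2 ≠ 0 := by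
    have h : ∑ n, normWeight w n ^ 2 = (∑ n, w n ^ 2) / (∑ n, w n) ^ 2 := by
      simp only [normWeight, div_pow]
      rw [← Finset.sum_div]
    rw [h]
    exact div_ne_zero (sum_sq_ne_zero w hS) (pow_ne_zero 2 hS)
  rw [hcv, essHat_eq_inv_sum_normWeight_sq w hS]
  field_simp
  ring

/-! ### (25): the variance of a weighted combination of uncorrelated draws -/

variable {Ω : Type*} [MeasurableSpace Ω] {μ : Measure Ω}

/-- **(25)**: for square-integrable, pairwise uncorrelated `Z_n` with common variance `σ²` and
deterministic weights with `Σ w ≠ 0`,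
`Var[Σ_n w_n Z_n / Σ_n w_n] = σ² Σ_n w_n²/(Σ_n w_n)² = σ²/ESS^` — the weighted combination is worth
`ESS^` equally weighted draws. [cite: ElviraMartinoRobert2022, §4.1.2 eq. (24)–(25)] -/
theorem variance_weightedComb [IsProbabilityMeasure μ] {Z : Fin N → Ω → ℝ} (hZ : ∀ n, MemLp (Z n) 2 μ)
    (hcov : Pairwise fun n m ↦ cov[Z n, Z m; μ] = 0) {σ2 : ℝ} (hvar : ∀ n, Var[Z n; μ] = σ2)
    (w : Fin N → ℝ) (hS : ∑ n, w n ≠ 0) :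
    Var[fun ω ↦ (∑ n, w n * Z n ω) / ∑ n, w n; μ] = σ2 / essHat w := by
  -- the combination is `S⁻¹ • Σ_n (w n • Z n)`
  have hrepr : (fun ω ↦ (∑ n, w n * Z n ω) / ∑ n, w n) = (∑ n, w n)⁻¹ • ∑ n, w n • Z n := by
    funext ω
    simp [div_eq_inv_mul, Finset.sum_apply, smul_eq_mul]
  rw [hrepr, variance_smul, variance_sum fun n ↦ (hZ n).const_smul (w n)]
  -- covariances of the scaled draws
  have hc : ∀ n m, cov[w n • Z n, w m • Z m; μ] = w n * w m * cov[Z n, Z m; μ] := fun n m ↦ by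
    rw [covariance_smul_left, covariance_smul_right, mul_assoc]
  have hdiag : ∀ n, ∑ m, cov[w n • Z n, w m • Z m; μ] = w n ^ 2 * σ2 := fun n ↦ by
    rw [Finset.sum_eq_single n (fun m _ hmn ↦ by rw [hc, hcov (Ne.symm hmn), mul_zero])
      (fun h ↦ absurd (mem_univ n) h), hc, covariance_self (hZ n).aemeasurable, hvar n]
    ring
  simp only [hdiag, ← Finset.sum_mul]
  have hQ := sum_sq_ne_zero w hS
  unfold essHat
  field_simp

/-! ### The `L_∞` effective sample size `1/max w̄` and the ordering
`1/max w̄ ≤ ESS^ ≤ (Σ √w̄)² ≤ N - N_Z` (Martino–Elvira–Louzada 2017; appended, lit g29) -/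

section Ordering

/-- The largest normalised weight `max_n w̄_n = ‖w̄‖_∞` (eq. (20)); a supremum over `Fin N`
(the junk value `0` for `N = 0` is never used: every statement below carries `N ≠ 0`).
[cite: MartinoElviraLouzada2017, §4 eq. (20)] -/
def maxNormWeight (w : Fin N → ℝ) : ℝ := ⨆ n, normWeight w n

/-- `D_N^{(∞)}(w̄) = 1/max[w̄_1, …, w̄_N]`, the `L_∞` effective sample size.
[cite: MartinoElviraLouzada2017, §4 eq. (21)] -/
def essMax (w : Fin N → ℝ) : ℝ := 1 / maxNormWeight w

/-- `S_N^{(1/2)}(w̄) = (Σ_n √w̄_n)²`. [cite: MartinoElviraLouzada2017, §5.3 eq. (36)] -/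
def essSqrt (w : Fin N → ℝ) : ℝ := (∑ n, Real.sqrt (normWeight w n)) ^ 2

/-- `V_N^{(0)}(w̄) = N - N_Z`, the number of NONZERO weights (Hamming distance to the null vector).
[cite: MartinoElviraLouzada2017, §4 eq. (18)–(19)] -/
def essSupport (w : Fin N → ℝ) : ℕ := (Finset.univ.filter fun n ↦ w n ≠ 0).card

/-- Normalised nonnegative weights are nonnegative (private plumbing). [folklore] -/
private theorem normWeight_nonneg {w : Fin N → ℝ} (hw : ∀ n, 0 ≤ w n) (n : Fin N) :
    0 ≤ normWeight w n :=
  div_nonneg (hw n) (Finset.sum_nonneg fun m _ ↦ hw m)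

/-- Each normalised weight is at most the largest one (private plumbing). [folklore] -/
private theorem normWeight_le_maxNormWeight (w : Fin N → ℝ) (n : Fin N) :
    normWeight w n ≤ maxNormWeight w :=
  le_ciSup (Set.finite_range _).bddAbove n

/-- The largest normalised weight is attained (private plumbing; `N ≠ 0`). [folklore] -/
private theorem exists_normWeight_eq_maxNormWeight (w : Fin N → ℝ) (hN : N ≠ 0) :
    ∃ n, normWeight w n = maxNormWeight w := by
  haveI : Nonempty (Fin N) := ⟨⟨0, Nat.pos_of_ne_zero hN⟩⟩
  exact exists_eq_ciSup_of_finite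

/-- `max_n w̄_n ≤ 1` for nonnegative weights with `Σ w ≠ 0` (`N ≠ 0`): every `w̄_n ≤ Σ_m w̄_m = 1`.
[cite: MartinoElviraLouzada2017, §4 eq. (20)–(21)] ("`1 ≤ D_N^{(∞)}(w̄)`") -/
theorem maxNormWeight_le_one (w : Fin N → ℝ) (hw : ∀ n, 0 ≤ w n) (hS : ∑ n, w n ≠ 0) (hN : N ≠ 0) :
    maxNormWeight w ≤ 1 := by
  obtain ⟨n, hn⟩ := exists_normWeight_eq_maxNormWeight w hN
  rw [← hn, ← sum_normWeight w hS]
  exact Finset.single_le_sum (fun m _ ↦ normWeight_nonneg hw m) (mem_univ n)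

/-- `1/N ≤ max_n w̄_n` (`Σ w ≠ 0`, `N ≠ 0`): the average of the `w̄_n` is `1/N`.
[cite: MartinoElviraLouzada2017, §4 eq. (20)–(21)] ("`D_N^{(∞)}(w̄) ≤ N`") -/
theorem inv_card_le_maxNormWeight (w : Fin N → ℝ) (hS : ∑ n, w n ≠ 0) (hN : N ≠ 0) :
    ((N : ℝ))⁻¹ ≤ maxNormWeight w := by
  have hN' : (0 : ℝ) < N := by exact_mod_cast Nat.pos_of_ne_zero hN
  have h : ∑ n, normWeight w n ≤ ∑ _n : Fin N, maxNormWeight w :=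
    Finset.sum_le_sum fun n _ ↦ normWeight_le_maxNormWeight w n
  rw [sum_normWeight w hS, Finset.sum_const, Finset.card_univ, Fintype.card_fin, nsmul_eq_mul] at h
  rw [inv_le_iff_one_le_mul₀ hN']
  linarith

/-- **`1 ≤ D_N^{(∞)}(w̄)`** (nonnegative weights, `Σ w ≠ 0`, `N ≠ 0`).
[cite: MartinoElviraLouzada2017, §4 eq. (21)] -/
theorem one_le_essMax (w : Fin N → ℝ) (hw : ∀ n, 0 ≤ w n) (hS : ∑ n, w n ≠ 0) (hN : N ≠ 0) :
    1 ≤ essMax w := by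
  have hpos : 0 < maxNormWeight w :=
    lt_of_lt_of_le (by positivity) (inv_card_le_maxNormWeight w hS hN)
  unfold essMax
  rw [le_div_iff₀ hpos, one_mul]
  exact maxNormWeight_le_one w hw hS hN

/-- **`D_N^{(∞)}(w̄) ≤ N`** (`Σ w ≠ 0`, `N ≠ 0`). [cite: MartinoElviraLouzada2017, §4 eq. (21)] -/
theorem essMax_le_card (w : Fin N → ℝ) (hS : ∑ n, w n ≠ 0) (hN : N ≠ 0) : essMax w ≤ N := by
  have hN' : (0 : ℝ) < N := by exact_mod_cast Nat.pos_of_ne_zero hN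
  have hpos : 0 < maxNormWeight w :=
    lt_of_lt_of_le (by positivity) (inv_card_le_maxNormWeight w hS hN)
  unfold essMax
  rw [div_le_iff₀ hpos]
  have h := inv_card_le_maxNormWeight w hS hN
  rw [inv_le_iff_one_le_mul₀ hN'] at h
  linarith

/-- `Σ_n w̄_n² ≤ max_n w̄_n` for nonnegative weights (`Σ w̄_n² ≤ Σ w̄_n · max = max`; private
plumbing). [folklore] -/
private theorem sum_normWeight_sq_le_maxNormWeight (w : Fin N → ℝ) (hw : ∀ n, 0 ≤ w n)
    (hS : ∑ n, w n ≠ 0) : ∑ n, normWeight w n ^ 2 ≤ maxNormWeight w := by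
  calc ∑ n, normWeight w n ^ 2 ≤ ∑ n, normWeight w n * maxNormWeight w :=
        Finset.sum_le_sum fun n _ ↦ by
          rw [sq]
          exact mul_le_mul_of_nonneg_left (normWeight_le_maxNormWeight w n) (normWeight_nonneg hw n)
    _ = maxNormWeight w := by rw [← Finset.sum_mul, sum_normWeight w hS, one_mul]

/-- **`D_N^{(∞)}(w̄) ≤ P_N^{(2)}(w̄)`**: `1/max w̄ ≤ ESS^ = 1/Σ w̄²` for nonnegative weights with
`Σ w ≠ 0`. [cite: MartinoElviraLouzada2017, §5.5 (ordering inequalities)] -/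
theorem essMax_le_essHat (w : Fin N → ℝ) (hw : ∀ n, 0 ≤ w n) (hS : ∑ n, w n ≠ 0) :
    essMax w ≤ essHat w := by
  have hQpos : 0 < ∑ n, normWeight w n ^ 2 := by
    rw [← one_div_pos, ← essHat_eq_inv_sum_normWeight_sq w hS]
    exact lt_of_lt_of_le zero_lt_one (one_le_essHat w hw hS)
  rw [essHat_eq_inv_sum_normWeight_sq w hS, essMax]
  exact one_div_le_one_div_of_le hQpos (sum_normWeight_sq_le_maxNormWeight w hw hS)

/-- **`P_N^{(2)}(w̄) ≤ S_N^{(1/2)}(w̄)`**: `ESS^ ≤ (Σ √w̄_n)²` for nonnegative weights with `Σ w ≠ 0`.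
Proof: with `s_n = √w̄_n`, Cauchy–Schwarz twice gives `(Σ s²)² ≤ (Σ s)(Σ s³)` and
`(Σ s³)² ≤ (Σ s²)(Σ s⁴)`, so `(Σ s²)³ ≤ (Σ s)²(Σ s⁴)`, i.e. `1 ≤ (Σ √w̄)² · Σ w̄²`.
[cite: MartinoElviraLouzada2017, §5.5 (ordering inequalities)] -/
theorem essHat_le_essSqrt (w : Fin N → ℝ) (hw : ∀ n, 0 ≤ w n) (hS : ∑ n, w n ≠ 0) :
    essHat w ≤ essSqrt w := by
  set s : Fin N → ℝ := fun n ↦ Real.sqrt (normWeight w n) with hs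
  have hs0 : ∀ n, 0 ≤ s n := fun n ↦ Real.sqrt_nonneg _
  have hs2 : ∀ n, s n ^ 2 = normWeight w n := fun n ↦ Real.sq_sqrt (normWeight_nonneg hw n)
  have hsum2 : ∑ n, s n ^ 2 = 1 := by simp only [hs2, sum_normWeight w hS]
  have hQ : ∑ n, normWeight w n ^ 2 = ∑ n, s n ^ 4 :=
    Finset.sum_congr rfl fun n _ ↦ by rw [← hs2 n]; ring
  have hQpos : 0 < ∑ n, normWeight w n ^ 2 := by
    rw [← one_div_pos, ← essHat_eq_inv_sum_normWeight_sq w hS]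
    exact lt_of_lt_of_le zero_lt_one (one_le_essHat w hw hS)
  -- Cauchy–Schwarz, twice
  have cs1 : (∑ n, s n ^ 2) ^ 2 ≤ (∑ n, s n) * ∑ n, s n ^ 3 := by
    have h := sum_mul_sq_le_sq_mul_sq Finset.univ (fun n ↦ Real.sqrt (s n))
      (fun n ↦ Real.sqrt (s n) * s n)
    have e1 : ∀ n, Real.sqrt (s n) * (Real.sqrt (s n) * s n) = s n ^ 2 := fun n ↦ by
      rw [← mul_assoc, Real.mul_self_sqrt (hs0 n)]; ring
    have e2 : ∀ n, Real.sqrt (s n) ^ 2 = s n := fun n ↦ Real.sq_sqrt (hs0 n)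
    have e3 : ∀ n, (Real.sqrt (s n) * s n) ^ 2 = s n ^ 3 := fun n ↦ by
      rw [mul_pow, Real.sq_sqrt (hs0 n)]; ring
    simp only [e1, e2, e3] at h
    exact h
  have cs2 : (∑ n, s n ^ 3) ^ 2 ≤ (∑ n, s n ^ 2) * ∑ n, s n ^ 4 := by
    have h := sum_mul_sq_le_sq_mul_sq Finset.univ (fun n ↦ s n) (fun n ↦ s n ^ 2)
    have e1 : ∀ n, s n * s n ^ 2 = s n ^ 3 := fun n ↦ by ring
    have e3 : ∀ n, (s n ^ 2) ^ 2 = s n ^ 4 := fun n ↦ by ring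
    simp only [e1, e3] at h
    exact h
  rw [hsum2] at cs1 cs2
  have hS3 : 0 ≤ ∑ n, s n ^ 3 := Finset.sum_nonneg fun n _ ↦ pow_nonneg (hs0 n) 3
  -- `1 ≤ (Σ s)² Σ s⁴`
  have key : 1 ≤ (∑ n, s n) ^ 2 * ∑ n, s n ^ 4 := by
    have h4 : 0 ≤ ∑ n, s n ^ 4 := Finset.sum_nonneg fun n _ ↦ pow_nonneg (hs0 n) 4
    nlinarith [cs1, cs2, hS3, h4, sq_nonneg (∑ n, s n)]
  rw [essHat_eq_inv_sum_normWeight_sq w hS, essSqrt, hQ, div_le_iff₀ (hQ ▸ hQpos)]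
  simpa only [hs] using key

/-- **`S_N^{(1/2)}(w̄) ≤ V_N^{(0)}(w̄)`**: `(Σ √w̄_n)² ≤ #{n : w_n ≠ 0}` for nonnegative weights with
`Σ w ≠ 0` (Cauchy–Schwarz on the support, where `Σ w̄ = 1`).
[cite: MartinoElviraLouzada2017, §5.5 (ordering inequalities)] -/
theorem essSqrt_le_essSupport (w : Fin N → ℝ) (hw : ∀ n, 0 ≤ w n) (hS : ∑ n, w n ≠ 0) :
    essSqrt w ≤ essSupport w := by
  -- indicator of the support
  set g : Fin N → ℝ := fun n ↦ if w n ≠ 0 then 1 else 0 with hg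
  have hg2 : ∀ n, g n ^ 2 = g n := fun n ↦ by
    by_cases h : w n ≠ 0 <;> simp [hg, h]
  have hmul : ∀ n, Real.sqrt (normWeight w n) * g n = Real.sqrt (normWeight w n) := fun n ↦ by
    by_cases h : w n ≠ 0
    · simp [hg, h]
    · have h0 : w n = 0 := not_not.1 h
      simp [hg, h0, normWeight]
  have cs := sum_mul_sq_le_sq_mul_sq Finset.univ (fun n ↦ Real.sqrt (normWeight w n)) g
  simp only [hmul, Real.sq_sqrt (normWeight_nonneg hw _), sum_normWeight w hS, one_mul, hg2] at cs
  have hcard : ∑ n, g n = (essSupport w : ℝ) := by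
    simp only [hg, essSupport]
    exact Finset.sum_boole _ _
  rw [essSqrt, ← hcard]
  exact cs

/-- The immediate companion of the chain (not among the printed inequalities): `ESS^ ≤ 1/(max w̄)²`,
since `Σ w̄² ≥ (max w̄)²`; equivalently the largest share of `Σ w²`, `(max w̄)²·ESS^`, is `≤ 1`
(`Σ w ≠ 0`, `N ≠ 0`; any real weights). [cite: MartinoElviraLouzada2017, §4 eq. (20)–(21) (D_N^{(∞)}; the bound is a one-line consequence, not printed)] -/
theorem essHat_le_inv_maxNormWeight_sq (w : Fin N → ℝ) (hS : ∑ n, w n ≠ 0) (hN : N ≠ 0) :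
    essHat w ≤ 1 / maxNormWeight w ^ 2 := by
  obtain ⟨n, hn⟩ := exists_normWeight_eq_maxNormWeight w hN
  have hpos : 0 < maxNormWeight w :=
    lt_of_lt_of_le (by positivity) (inv_card_le_maxNormWeight w hS hN)
  rw [essHat_eq_inv_sum_normWeight_sq w hS]
  refine one_div_le_one_div_of_le (pow_pos hpos 2) ?_
  rw [← hn]
  exact Finset.single_le_sum (fun m _ ↦ sq_nonneg (normWeight w m)) (mem_univ n)

end Ordering

end Literature.Probability.ImportanceSampling
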